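import Mathlib.Geometry.Manifold.LocalDiffeomorph
import Mathlib.Geometry.Manifold.MFDeriv.Basic
import Mathlib.Analysis.InnerProductSpace.Basic
import Mathlib.Analysis.SpecialFunctions.Exp
import Literature.Geometry.Lorentzian.PseudoRiemannianMetric
import HarnessLib

/-!
# Locally conformally flat (pseudo-)Riemannian metrics

Topic: `Literature/Geometry/Riemannian`. Definition request `defn-IsLocallyConformallyFlat`
(route `SmoothPoincare4/PIC`, crux 4; the fact `Kuiper1949`).

## Content

For a `C^n` pseudo-Riemannian metric `g` on the tangent bundle of a manifold `M` modelled on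
`I : ModelWithCorners ℝ E H` whose model vector space `E` is a real inner product space (the flat
reference metric `δ = ⟪·,·⟫`):

* `IsConformallyFlatNear g x₀` — `x₀` has local coordinates `φ` (a `C^∞` local diffeomorphism
  into `E` at `x₀`, Mathlib `IsLocalDiffeomorphAt`) and a function `u` with
  `g_x(v, w) = e^{2 u(x)} ⟪dφ_x v, dφ_x w⟫` for all `x` near `x₀`, i.e. `g = e^{2u} φ^* δ` near
  `x₀` (Besse 1987, Def. 1.164 / §1.J; Kuiper 1949, §1).
* `IsLocallyConformallyFlat g` — every point is such (Besse 1987, Def. 1.164 ("conformally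
  flat"); Kuiper 1949).

## Sources

* A. Besse, *Einstein Manifolds*, Springer 1987, §1.J, Def. 1.164 (conformally flat: near every point some `e^{2f} g` is
  flat), Thm. 1.165 (`n ≥ 4`: conformally flat iff `W = 0`), 1.170 (dimension 3), Thm. 1.171 (Kuiper);
  1.159 is the theorem listing the invariants of `e^{2f} g` (regrounded 2026-08-14 against the text).
* N. Kuiper, *On conformally-flat spaces in the large*, Ann. of Math. 50 (1949), 916–924, §1.

## Design choices and remarks

* Charts are phrased as `C^∞` local diffeomorphisms `φ : M → E` at `x₀` (Mathlib
  `IsLocalDiffeomorphAt I 𝓘(ℝ, E) ∞ φ x₀`) rather than members of the atlas, so that the notion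
  does not depend on the chosen `ChartedSpace` structure beyond its smooth structure; the flat
  metric is transported by `mfderiv`. The tangent space `TangentSpace 𝓘(ℝ, E) (φ x)` is `E`
  definitionally, where the inner product is taken.
* The conformal factor is written `e^{2u}` with `u : M → ℝ` arbitrary; its smoothness near `x₀`
  is automatic from that of `g` and `φ` (it is `½ log (g(v,v)/⟪dφ v, dφ v⟫)` for any fixed
  non-zero `v`) and is therefore not imposed.
* Stated for pseudo-Riemannian `g` (as requested, over `Literature.Geometry.Lorentzian.PseudoRiemannianMetric`); for
  a metric of non-zero index the condition is unsatisfiable (the right-hand side is positive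
  definite), so for Lorentzian conformal flatness one would replace `⟪·,·⟫` by a Minkowski form —
  not needed by the requester (Riemannian PIC route).
* The equivalent curvature criteria (Weyl tensor `W = 0` in dimension `≥ 4`, Cotton tensor in
  dimension `3`; Besse 1.165, 1.170) are theorems requiring the Weyl tensor, which the tree does not
  have yet; they are not part of this definition.
-/

open Manifold Bundle Set Filter
open scoped ContDiff Topology RealInnerProductSpace

noncomputable section

namespace Literature.Geometry.Riemannian

variable {E : Type*} [NormedAddCommGroup E] [InnerProductSpace ℝ E] {H : Type*}
  [TopologicalSpace H] {I : ModelWithCorners ℝ E H} {n : ℕ∞ω} {M : Type*} [TopologicalSpace M]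
  [ChartedSpace H M] [IsManifold I ∞ M]

/-- The differential `dφ_x : T_x M → E` of a coordinate map `φ : M → E`, i.e. `mfderiv` with its
target `TangentSpace 𝓘(ℝ, E) (φ x)` read as the model inner-product space `E` (definitionally
equal). [folklore] -/
def coordDeriv (φ : M → E) (x : M) : TangentSpace I x →L[ℝ] E :=
  mfderiv I 𝓘(ℝ, E) φ x

omit [IsManifold I ∞ M] in
/-- `coordDeriv` is `mfderiv`. [folklore] -/
@[simp] theorem coordDeriv_apply (φ : M → E) (x : M) (v : TangentSpace I x) :
    coordDeriv (I := I) φ x v = mfderiv I 𝓘(ℝ, E) φ x v := rfl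

section PseudoRiemannianMetric
open Literature.Geometry.Lorentzian (PseudoRiemannianMetric)
open Literature.Geometry.Lorentzian.PseudoRiemannianMetric

/-- `g` is **conformally flat near `x₀`** in the coordinates `φ` with conformal factor `e^{2u}`:
`φ` is a smooth local diffeomorphism into the model inner-product space `E` at `x₀` and
`g_x(v, w) = e^{2u(x)} ⟪dφ_x v, dφ_x w⟫` for all `x` in a neighbourhood of `x₀`
(Besse 1987, Def. 1.164; Kuiper 1949, §1). [cite: Besse1987, Def. 1.164] -/
def _root_.Literature.Geometry.Lorentzian.PseudoRiemannianMetric.IsConformallyFlatIn (g : PseudoRiemannianMetric I n E (TangentSpace I : M → Type _))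
    (x₀ : M) (φ : M → E) (u : M → ℝ) : Prop :=
  IsLocalDiffeomorphAt I 𝓘(ℝ, E) ∞ φ x₀ ∧
    ∀ᶠ x in 𝓝 x₀, ∀ v w : TangentSpace I x,
      g.val x v w =
        Real.exp (2 * u x) * ⟪coordDeriv (I := I) φ x v, coordDeriv (I := I) φ x w⟫

/-- `g` is **conformally flat near `x₀`**: there are local coordinates `φ` at `x₀` and a
function `u` with `g = e^{2u} φ^*⟪·,·⟫` on a neighbourhood of `x₀` (Besse 1987, Def. 1.164).
[cite: Besse1987, Def. 1.164] -/
def _root_.Literature.Geometry.Lorentzian.PseudoRiemannianMetric.IsConformallyFlatNear (g : PseudoRiemannianMetric I n E (TangentSpace I : M → Type _))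
    (x₀ : M) : Prop :=
  ∃ (φ : M → E) (u : M → ℝ), g.IsConformallyFlatIn x₀ φ u

/-- **Locally conformally flat** metric: every point of `M` has local coordinates in which
`g = e^{2u} · (Euclidean metric of the model space)` (Besse 1987, Def. 1.164; Kuiper 1949, §1).
Equivalent, in dimension `≥ 4`, to the vanishing of the Weyl tensor (Besse 1987, 1.165; not
formalised here). [cite: Besse1987, Def. 1.164] -/
def _root_.Literature.Geometry.Lorentzian.PseudoRiemannianMetric.IsLocallyConformallyFlat
    (g : PseudoRiemannianMetric I n E (TangentSpace I : M → Type _)) : Prop :=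
  ∀ x₀ : M, g.IsConformallyFlatNear x₀

/-! ### API -/

variable {g : PseudoRiemannianMetric I n E (TangentSpace I : M → Type _)} {x₀ : M}
  {φ : M → E} {u : M → ℝ}

/-- Unfolding of local conformal flatness at a point. [cite: Besse1987, Def. 1.164] -/
theorem _root_.Literature.Geometry.Lorentzian.PseudoRiemannianMetric.isConformallyFlatNear_iff :
    g.IsConformallyFlatNear x₀ ↔ ∃ (φ : M → E) (u : M → ℝ), g.IsConformallyFlatIn x₀ φ u :=
  Iff.rfl

/-- The coordinates witnessing conformal flatness are a local diffeomorphism at the point.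
[cite: Besse1987, Def. 1.164] -/
theorem _root_.Literature.Geometry.Lorentzian.PseudoRiemannianMetric.IsConformallyFlatIn.isLocalDiffeomorphAt (h : g.IsConformallyFlatIn x₀ φ u) :
    IsLocalDiffeomorphAt I 𝓘(ℝ, E) ∞ φ x₀ :=
  h.1

/-- In conformally flat coordinates the metric is a positive multiple of the flat metric, in
particular `g_x(v, v) = e^{2u(x)} ‖dφ_x v‖²` near `x₀`. [cite: Besse1987, Def. 1.164] -/
theorem _root_.Literature.Geometry.Lorentzian.PseudoRiemannianMetric.IsConformallyFlatIn.eventually_val_self (h : g.IsConformallyFlatIn x₀ φ u) :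
    ∀ᶠ x in 𝓝 x₀, ∀ v : TangentSpace I x,
      g.val x v v = Real.exp (2 * u x) * ‖coordDeriv (I := I) φ x v‖ ^ 2 := by
  filter_upwards [h.2] with x hx v
  rw [hx v v, real_inner_self_eq_norm_sq]

/-- In conformally flat coordinates `g_x(v, v) ≥ 0` near `x₀`: a locally conformally flat metric
in this (Riemannian-model) sense is positive semidefinite near every point, hence the notion is
void for metrics of positive index (see the module docstring). [cite: Besse1987, Def. 1.164] -/
theorem _root_.Literature.Geometry.Lorentzian.PseudoRiemannianMetric.IsConformallyFlatIn.eventually_val_self_nonneg (h : g.IsConformallyFlatIn x₀ φ u) :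
    ∀ᶠ x in 𝓝 x₀, ∀ v : TangentSpace I x, 0 ≤ g.val x v v := by
  filter_upwards [h.eventually_val_self] with x hx v
  rw [hx v]
  positivity

/-- Changing the regularity index does not affect local conformal flatness (`ofLE` keeps `val`).
[folklore] -/
theorem _root_.Literature.Geometry.Lorentzian.PseudoRiemannianMetric.IsConformallyFlatIn.ofLE {n' : ℕ∞ω} (h : g.IsConformallyFlatIn x₀ φ u) (hn : n' ≤ n) :
    (g.ofLE hn).IsConformallyFlatIn x₀ φ u :=
  h

/-- Changing the regularity index does not affect local conformal flatness. [folklore] -/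
theorem _root_.Literature.Geometry.Lorentzian.PseudoRiemannianMetric.IsLocallyConformallyFlat.ofLE {n' : ℕ∞ω} (h : g.IsLocallyConformallyFlat) (hn : n' ≤ n) :
    (g.ofLE hn).IsLocallyConformallyFlat :=
  h

end PseudoRiemannianMetric

end Literature.Geometry.Riemannian

end
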